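import Summits.QuantumFields.YangMills.Theorems.BalabanLadderIRColdPressurePincerDefs
import Literature.MathematicalPhysics.QuantumFieldTheory.Balaban1983to89.InfiniteVolumeSufficientXII
import HarnessLib

/-!
# Crux `IR` (stmt-QuantumFields-19354), line `ym-ir7-volume-monotone-gap` (ideator ym-ir-idea-7): the line's VOCABULARY as tree constants

Helper module for item `stmt-QuantumFields-19354` (`--supports … --as helper`; it closes nothing).  Pooled prover ym-ir-line-pool-p3 (g5).
The five statements of the crux workfile `Cruxes/IR/Lines/ym_ir7_volume_monotone_gap.lean` (skeleton v5.2, commit 158cc0b02cb1) —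
`FiniteVolumeGapSC` (stub FV), `VolumeMonotoneSC` (stub MONO), `VolumeMonotoneStrongCoupling` (rung MONO-sc), `VolumeMonotoneStrongCouplingWindow`
(rung MONO-sc-window) and the named input `TraceExcessFloorSC` (T-GAP-FINITE-sc) — made tree constants VERBATIM (same namespace
`Summit.QuantumFields.YangMills.Cruxes.IR.VolumeMonotone`), together with two of the skeleton's proved seams (`coldPressureBound_mono_const`, `rate_le_of_traceExcessFloor`; the third,
`coldPressureBound_mono_rate`, is already the tree constant `TensionRatio.coldPressureBound_mono_rate` of `Theorems/IR/TensionRatioDefs.lean`), so that the skeleton re-bases on `import …Theorems.IR.VolumeMonotoneDefs` and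
the window rung can be closed BY NAME by a `Theorems/` file (`VolumeMonotoneWindowRung.lean`: `volumeMonotoneStrongCouplingWindow_holds`).
NEW here: `TraceExcessFloorSCWindow` — the input T-GAP-FINITE-sc on the ENGINE window `[β₁, βF]`, `βF ≤ strongCouplingRadius r.ρ` chosen per
`(G, r)` (the typed `TraceExcessFloorSC` asks for the full window up to `strongCouplingRadius r.ρ`, which the tree's floor engine
`SCFloor.facingPlaquetteCorr_floor_latticeRep` does not reach; the window form is what `VolumeMonotoneTraceExcessFloor.traceExcess_floor_strongCoupling`
proves and all the window rung needs, since that rung carries its own `∃ βD`); `traceExcessFloorSC_imp_window` records that it is a WEAKENING.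
Nothing is asserted: `def … : Prop` statements (conjectural obligations of the line stay open) and kernel-checked seams.

HONEST FRAMING: vocabulary of ONE conditional line (SUBSUMED mod currency by the FSS line, census §L row 7) of the OPEN gap-crux `IR`; the loads FV / MONO
are untouched; the YM mass gap (Clay) is NOT proved; `R4` closes only the conditional rung `BalabanLadder.UV`.
Refs: skeleton and card `Cruxes/IR/Lines/ym_ir7_volume_monotone_gap.lean` / `ym-ir7-volume-monotone-gap.md` (ideator ym-ir-idea-7 g0–g3).
-/

set_option autoImplicit false

noncomputable section

open Filter Topology MeasureTheory
open Literature.MathematicalPhysics.QuantumFieldTheory Literature.MathematicalPhysics.QuantumLattice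
open Summit.QuantumFields.YangMills.Cruxes.OSLegsFromFemtoAndGap.DlrCollarTransfer (GapInUnits LowerBounds)
open Literature.MathematicalPhysics.QuantumFieldTheory.Balaban1983to89.Sufficient (ColdPressureBound)
open Literature.MathematicalPhysics.QuantumFieldTheory.Balaban1983to89.Missing (strongCouplingRadius strongCouplingRadius_pos)

namespace Summit.QuantumFields.YangMills.Cruxes.IR.VolumeMonotone

/-! ## §0 The two stub STATEMENTS (periodic free-energy currency, simply-connected family) -/

/-- **stub FV — FINITE-PHYSICAL-VOLUME TRANSFER GAP IN UNITS (simply-connected simple `G`).**  For every `(G, r)` and every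
positive unit map `a → 0` carrying the non-triviality floors (`LowerBounds`, used as the UNIT PIN: in a unit coarser than
physical the statement is false, in a finer one it is weaker), there is a physical size `ℓ₀` such that at EVERY fixed
physical size `ℓ ≥ ℓ₀` the spatial torus of `⌈ℓ ∕ a β⌉₊` half-sides obeys the cold trace bound at lattice rate `c(ℓ)·a(β)`
with one constant `C₀(ℓ)`, for all large `β`: the periodic transfer gap of ONE box of fixed physical size, in physical
units, eventually in `β` (constants MAY depend on `ℓ`; no uniformity in the volume is asked).  Wall: continuum limit of the
finite-volume transfer spectrum (UV, Bałaban-side) + the finite-volume spectral problem at size `ℓ` (zero-mode effective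
Hamiltonian beyond the sphaleron, van Baal–Koller); NOT infinite-volume thermodynamics. [conjectural obligation; open] -/
def FiniteVolumeGapSC : Prop :=
  ∀ (G : Type) [Group G] [TopologicalSpace G] [IsTopologicalGroup G] [CompactSpace G],
    IsCompactSimpleLieGroup G → SimplyConnectedSpace G →
    letI : MeasurableSpace G := borel G; haveI : BorelSpace G := ⟨rfl⟩;
    ∀ (r : LatticeRep G) (a : ℝ → ℝ), (∀ β, 0 < a β) → Tendsto a atTop (nhds 0) → LowerBounds G r a →
      ∃ ℓ₀ : ℝ, ∀ ℓ : ℝ, ℓ₀ ≤ ℓ → ∃ c : ℝ, 0 < c ∧ ∃ C₀ : ℝ, 0 ≤ C₀ ∧ ∃ β₂ : ℝ, ∀ β : ℝ, β₂ ≤ β →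
        ColdPressureBound r.ρ β ⌈ℓ / a β⌉₊ (c * a β) C₀

/-- **stub MONO — SPATIAL-VOLUME MONOTONICITY OF THE TRANSFER GAP BEYOND `ℓ⋆` (simply-connected simple `G`).**  For every
`(G, r, a)` as above there are a physical size `ℓ⋆ > 0`, an amplitude constant `K ≥ 1`, a threshold `β₃`
and a rate-retention factor `θ ∈ (0, 1]` (stated `∃ θ`, the weakest form the composition needs — no hand-picked `1∕2`)
such that for `β ≥ β₃` and all spatial half-sides `S ≤ S'` with `ℓ⋆ ≤ a β · S`: a cold trace bound at size `S` with rate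
`g > 0` and constant `C₀ ≥ 1` implies the cold trace bound at size `S'` with rate `θ·g` and constant `K·C₀` («enlarging the
torus past one deconfinement length costs at most the factor `θ` in the gap»).  Since the cold range is unbounded in `t`, the
hypothesis forces `g ≤ m(β, S)` (the transfer gap at size `S`), so the content is `m(β, S') ≥ θ·m(β, S)` for ALL `S' ≥ S`
(this IS the infinite-volume content of `IR`, isolated as a two-volume comparison) plus amplitude regularity of the excited
tower (`Σ_i e^{-(ΔE_i' − m')t'} ≤ K·(2S'+1)³` in the cold range).  The floor `1 ≤ C₀` is load-bearing: with `C₀` free a tiny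
amplitude encodes a rate better than `g` at `t = (S+1)∕2` and the statement would silently demand EXACT monotonicity
`m(β, S') ≥ m(β, S) − o(1)`.  Calibrated by large-`N` volume independence (exact, `θ = K = 1`, beyond `ℓ_c`) and Lüscher's
negative finite-size mass shift; FALSE below `ℓ⋆` (femto ∕ critical scaling `m ∝ 1∕S`), which is why `ℓ⋆` and the unit pin
`LowerBounds` are load-bearing.  Tools on record: RP log-convexity of `log Z` in each period
(`wilsonFinTorusPartition_two_mul_le_sq` is the time-direction instance); no proof route known — typed conjectural
obligation. [open] -/
def VolumeMonotoneSC : Prop :=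
  ∀ (G : Type) [Group G] [TopologicalSpace G] [IsTopologicalGroup G] [CompactSpace G],
    IsCompactSimpleLieGroup G → SimplyConnectedSpace G →
    letI : MeasurableSpace G := borel G; haveI : BorelSpace G := ⟨rfl⟩;
    ∀ (r : LatticeRep G) (a : ℝ → ℝ), (∀ β, 0 < a β) → Tendsto a atTop (nhds 0) → LowerBounds G r a →
      ∃ ℓs : ℝ, 0 < ℓs ∧ ∃ θ : ℝ, 0 < θ ∧ θ ≤ 1 ∧ ∃ K : ℝ, 1 ≤ K ∧ ∃ β₃ : ℝ, ∀ β : ℝ, β₃ ≤ β →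
        ∀ S S' : ℕ, ℓs ≤ a β * S → S ≤ S' → ∀ g C₀ : ℝ, 0 < g → 1 ≤ C₀ →
          ColdPressureBound r.ρ β S g C₀ → ColdPressureBound r.ρ β S' (θ * g) (K * C₀)

/-! ### BC5-type RUNG (typed; the strong-coupling instance of the MONO format — a FORMAT exercise inside `IR`'s known regime, not a
witness of weakness; requested by ym-ir-crit-1's standing rule «pincer-currency lines carry a typed rung»; answers crit-2's P3 in d = 4) -/

/-- **rung MONO-sc — volume monotonicity of the cold trace bound at STRONG COUPLING.**  For `0 < β ≤ β_D(G,r)`: the strong-coupling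
transfer spectrum on the spatial torus `(2S+1)³` is volume-uniform (lightest state = glueball `m(β) = −4 ln u + …`, torelons `≥ σ(β)(2S+1)`
heavier once `2S+1 > 4`), so a cold trace bound at size `S ≥ S₀` with ANY admissible rate `g` (`g ≤ E₁(S)` is forced by the floor `1 ≤ C₀`)
transports to every `S' ≥ S` at rate `θg` and amplitude `K·C₀`.  v5 RE-PRICING: because admissible `g` reaches `m(β,S) ≈ −4 ln u(β) → ∞`
as `β → 0⁺`, ONE `θ` on all of `(0, β_D]` needs (a) a RATE-TRACKING strong-coupling cold-pressure bound (rate `κ ln(1∕(C′β))`, `κ = 1` for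
the tree's plaquette-polymer gas, whose time-wrapping clusters have `≥ m+2` plaquettes; `Missing.coldFreeEnergyBound_of_strongCoupling` books the
β-independent rate `1∕4` only) AND (b) the β-explicit gap ceiling `m(β,S) ≤ 4 ln(1∕β) + c′` (variational principle + `Cov_vac(P₀,P₁) ≥ cβ⁴`);
then `θ = κ∕5`.  Two L inputs, neither in the tree.  The form
landable from ONE input is `VolumeMonotoneStrongCouplingWindow` below (proved from `TraceExcessFloorSC`). [rung; typed, two inputs short] -/
def VolumeMonotoneStrongCoupling : Prop :=
  ∀ (G : Type) [Group G] [TopologicalSpace G] [IsTopologicalGroup G] [CompactSpace G],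
    IsCompactSimpleLieGroup G → SimplyConnectedSpace G →
    letI : MeasurableSpace G := borel G; haveI : BorelSpace G := ⟨rfl⟩;
    ∀ (r : LatticeRep G), ∃ βD : ℝ, 0 < βD ∧ ∃ θ : ℝ, 0 < θ ∧ θ ≤ 1 ∧ ∃ K : ℝ, 1 ≤ K ∧ ∃ S₀ : ℕ,
      ∀ β : ℝ, 0 < β → β ≤ βD → ∀ S S' : ℕ, S₀ ≤ S → S ≤ S' → ∀ g C₀ : ℝ, 0 < g → 1 ≤ C₀ →
        ColdPressureBound r.ρ β S g C₀ → ColdPressureBound r.ρ β S' (θ * g) (K * C₀)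

/-- **rung MONO-sc-window — the MONO format on a compact strong-coupling window `[β₁, β_D]`** (`θ`, `K`, `S₀` may depend on `β₁`).
Weaker than `VolumeMonotoneStrongCoupling` (`monoWindow_of_mono`) and PROVED below from the single named input `TraceExcessFloorSC`
plus the tree's volume-uniform rate-`1∕8` strong-coupling bound (`monoWindow_of_traceExcessFloor`).  A FORMAT exercise inside `IR`'s
known regime (not a witness of weakness). [rung; reduced to `TraceExcessFloorSC`] -/
def VolumeMonotoneStrongCouplingWindow : Prop :=
  ∀ (G : Type) [Group G] [TopologicalSpace G] [IsTopologicalGroup G] [CompactSpace G],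
    IsCompactSimpleLieGroup G → SimplyConnectedSpace G →
    letI : MeasurableSpace G := borel G; haveI : BorelSpace G := ⟨rfl⟩;
    ∀ (r : LatticeRep G), ∃ βD : ℝ, 0 < βD ∧ ∀ β₁ : ℝ, 0 < β₁ → β₁ ≤ βD →
      ∃ θ : ℝ, 0 < θ ∧ θ ≤ 1 ∧ ∃ K : ℝ, 1 ≤ K ∧ ∃ S₀ : ℕ,
        ∀ β : ℝ, β₁ ≤ β → β ≤ βD → ∀ S S' : ℕ, S₀ ≤ S → S ≤ S' → ∀ g C₀ : ℝ, 0 < g → 1 ≤ C₀ →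
          ColdPressureBound r.ρ β S g C₀ → ColdPressureBound r.ρ β S' (θ * g) (K * C₀)

/-- **named input T-GAP-FINITE-sc — the torus transfer gap is FINITE, uniformly in the spatial volume, on every compact
strong-coupling window `[β₁, r_ρ]`:** `e^{−M(m+2)} ≤ traceExcess ρ β (2S+1) (m+2)` for `S ≥ S₀`, `m ≥ t₀` (equivalently
`λ₁∕λ₀ ≥ e^{−M}` for Lüscher's transfer matrix, since `traceExcess = Σ_{i≥1}(λᵢ∕λ₀)^{m+2} ≥ (λ₁∕λ₀)^{m+2}`).  TRUE and standard
(strong-coupling glueball mass `m(β) = −4 ln u(β) + O(u²)`, Montvay–Münster §3.4 ∕ Osterwalder–Seiler 1978 §3), NOT in the tree: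
the tree has only UPPER bounds on `traceExcess` (`Missing.traceExcess_le_of_strongCoupling`).  Route to a proof (size L): variational
principle `λ₁∕λ₀ ≥ Cov_vac(P₀, P₁) ∕ E_vac[P₀²]` + a volume-uniform FLOOR `Cov ≥ c·β^{n₀}∕2` on ONE connected plaquette correlator at
time distance 1 (fixed-order cluster expansion with volume-uniform remainder; box-to-torus transfer available as
`LatticeGaugeDLRCovarianceSplit.latticeConnectedCorr_ge_of_boxKernel_condCov`).  FALSE without non-triviality of `G`
(`G = 1`: `traceExcess = 0`), whence the `IsCompactSimpleLieGroup` binder. [input; provable, size L] -/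
def TraceExcessFloorSC : Prop :=
  ∀ (G : Type) [Group G] [TopologicalSpace G] [IsTopologicalGroup G] [CompactSpace G],
    IsCompactSimpleLieGroup G → SimplyConnectedSpace G →
    letI : MeasurableSpace G := borel G; haveI : BorelSpace G := ⟨rfl⟩;
    ∀ (r : LatticeRep G) (β₁ : ℝ), 0 < β₁ →
      ∃ M : ℝ, 0 < M ∧ ∃ S₀ t₀ : ℕ, ∀ β : ℝ, β₁ ≤ β → β ≤ strongCouplingRadius r.ρ →
        ∀ S : ℕ, S₀ ≤ S → ∀ m : ℕ, t₀ ≤ m →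
          Real.exp (-(M * ((m + 2 : ℕ) : ℝ))) ≤ traceExcess r.ρ β (2 * S + 1) (m + 2)


/-- **named input T-GAP-FINITE-sc on the ENGINE WINDOW** (the provable form of `TraceExcessFloorSC`): for every `(G, r)` there is a window cap
`0 < βF ≤ strongCouplingRadius r.ρ` such that on every compact window `[β₁, βF]` the floor `e^{−M(m+2)} ≤ traceExcess r.ρ β (2S+1) (m+2)` holds for
`S ≥ S₀`, `m ≥ t₀` with ONE `M = M(β₁)` — the torus transfer gap is FINITE, volume-uniformly (`λ₁/λ₀ ≥ e^{−M}`).  PROVED in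
`Theorems/IR/VolumeMonotoneWindowRung.lean` (`traceExcessFloorSCWindow_holds`, with `βF = min β₀ r_ρ`, `β₀` the cap of the tree's facing-plaquette
floor engine, and `M = log(1/(c₁β₁⁴))`, i.e. the β-explicit ceiling `4 log(1/β₁) + O(1)`). [input; window form; proved] -/
def TraceExcessFloorSCWindow : Prop :=
  ∀ (G : Type) [Group G] [TopologicalSpace G] [IsTopologicalGroup G] [CompactSpace G],
    IsCompactSimpleLieGroup G → SimplyConnectedSpace G →
    letI : MeasurableSpace G := borel G; haveI : BorelSpace G := ⟨rfl⟩;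
    ∀ (r : LatticeRep G), ∃ βF : ℝ, 0 < βF ∧ βF ≤ strongCouplingRadius r.ρ ∧ ∀ β₁ : ℝ, 0 < β₁ → β₁ ≤ βF →
      ∃ M : ℝ, 0 < M ∧ ∃ S₀ t₀ : ℕ, ∀ β : ℝ, β₁ ≤ β → β ≤ βF →
        ∀ S : ℕ, S₀ ≤ S → ∀ m : ℕ, t₀ ≤ m →
          Real.exp (-(M * ((m + 2 : ℕ) : ℝ))) ≤ traceExcess r.ρ β (2 * S + 1) (m + 2)

/-- The typed input implies its window form (the window form is a WEAKENING: restrict `β ≤ strongCouplingRadius r.ρ` to `β ≤ βF := r_ρ`). -/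
theorem traceExcessFloorSC_imp_window (h : TraceExcessFloorSC) : TraceExcessFloorSCWindow := by
  intro G _ _ _ _ hG hsc
  letI : MeasurableSpace G := borel G
  haveI : BorelSpace G := ⟨rfl⟩
  intro r
  refine ⟨strongCouplingRadius r.ρ, strongCouplingRadius_pos r.ρ, le_rfl, fun β₁ hβ₁ _ => ?_⟩
  obtain ⟨M, hM, S₀, t₀, hfl⟩ := h G hG hsc r β₁ hβ₁
  exact ⟨M, hM, S₀, t₀, fun β hβ1 hβF S hS m hm => hfl β hβ1 hβF S hS m hm⟩

/-! ## §2 Seams (real proofs) -/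

section Seams

variable {G : Type} [Group G] [TopologicalSpace G] [IsTopologicalGroup G] [CompactSpace G]
  [MeasurableSpace G] [BorelSpace G]

/-- A larger constant is a weaker cold trace bound. -/
theorem coldPressureBound_mono_const {N : ℕ} {ρ : G →* Matrix (Fin N) (Fin N) ℂ} {β : ℝ} {S : ℕ}
    {g C₀ C₀' : ℝ} (h : ColdPressureBound ρ β S g C₀) (hC : C₀ ≤ C₀') :
    ColdPressureBound ρ β S g C₀' := by
  intro m hm
  refine (h m hm).trans ?_
  have hV : 0 ≤ ((2 * S + 1 : ℕ) : ℝ) ^ 3 * Real.exp (-(g * ((m + 2 : ℕ) : ℝ))) := by positivity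
  nlinarith [mul_le_mul_of_nonneg_right hC hV]

/-- **Admissible-rate ceiling (kernel; reusable by every pincer-currency line).**  A floor `e^{−M(m+2)} ≤ traceExcess` for all
large `m` on the torus `(2S+1)³` caps the rate of every cold trace bound with `1 ≤ C₀` there: `g ≤ M` («an admissible cold-pressure
rate never exceeds the transfer gap»). -/
theorem rate_le_of_traceExcessFloor {N : ℕ} {ρ : G →* Matrix (Fin N) (Fin N) ℂ} {β : ℝ} {S t₀ : ℕ} {g C₀ M : ℝ}
    (hcp : ColdPressureBound ρ β S g C₀) (hC₀ : 1 ≤ C₀)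
    (hfloor : ∀ m : ℕ, t₀ ≤ m → Real.exp (-(M * ((m + 2 : ℕ) : ℝ))) ≤ traceExcess ρ β (2 * S + 1) (m + 2)) :
    g ≤ M := by
  by_contra hlt
  push Not at hlt
  set V : ℝ := C₀ * ((2 * S + 1 : ℕ) : ℝ) ^ 3 with hVdef
  have hV1 : 1 ≤ V := by
    have h1 : (1 : ℝ) ≤ ((2 * S + 1 : ℕ) : ℝ) ^ 3 := by
      have : (1 : ℝ) ≤ ((2 * S + 1 : ℕ) : ℝ) := by exact_mod_cast (show 1 ≤ 2 * S + 1 by omega)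
      exact one_le_pow₀ this
    nlinarith
  have hVpos : 0 < V := lt_of_lt_of_le one_pos hV1
  obtain ⟨m, hmt, hmS, hmV⟩ : ∃ m : ℕ, t₀ ≤ m ∧ S + 1 ≤ 2 * (m + 2) ∧
      Real.log V / (g - M) < ((m + 2 : ℕ) : ℝ) := by
    refine ⟨⌈Real.log V / (g - M)⌉₊ + t₀ + S, by omega, by omega, ?_⟩
    have hce : Real.log V / (g - M) ≤ ((⌈Real.log V / (g - M)⌉₊ : ℕ) : ℝ) := Nat.le_ceil _
    push_cast
    linarith
  set t : ℝ := ((m + 2 : ℕ) : ℝ) with htdef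
  have h1 : Real.exp (-(M * t)) ≤ traceExcess ρ β (2 * S + 1) (m + 2) := hfloor m hmt
  have h2 : traceExcess ρ β (2 * S + 1) (m + 2) ≤ V * Real.exp (-(g * t)) := hcp m hmS
  have h3 : Real.exp ((g - M) * t) ≤ V := by
    have h12 := mul_le_mul_of_nonneg_right (h1.trans h2) (Real.exp_nonneg (g * t))
    have hl : Real.exp (-(M * t)) * Real.exp (g * t) = Real.exp ((g - M) * t) := by
      rw [← Real.exp_add]; ring_nf
    have hr : V * Real.exp (-(g * t)) * Real.exp (g * t) = V := by
      rw [mul_assoc, ← Real.exp_add]; simp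
    rw [hl, hr] at h12
    exact h12
  have h4 : (g - M) * t ≤ Real.log V := by
    have := Real.log_le_log (Real.exp_pos _) h3
    rwa [Real.log_exp] at this
  have h5 : t ≤ Real.log V / (g - M) := by
    rw [le_div_iff₀ (by linarith)]
    linarith [mul_comm (g - M) t]
  linarith

end Seams

end Summit.QuantumFields.YangMills.Cruxes.IR.VolumeMonotone

end
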